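import Mathlib
import Summits.ValiantsHypothesis.ValiantsHypothesis.Theorems.DivisionGapPerCofactorDegreeReductionStubIsolatedStrip
import Summits.ValiantsHypothesis.ValiantsHypothesis.Theorems.DivisionGapPerCofactorDegreeReductionStubGadgetProjection
import Summits.ValiantsHypothesis.ValiantsHypothesis.Theorems.DivisionGapPerCofactorDegreeReductionStubTwoFactorRigidity
import Summits.ValiantsHypothesis.ValiantsHypothesis.Theorems.DivisionGapPerCofactorDegreeReductionStubGadgetPlacement
import Summits.ValiantsHypothesis.ValiantsHypothesis.Theorems.PerDivisionHard.Negative.PlainBridge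
import Literature.Computability.AlgebraicComplexity.PermanentIrreducible

/-!
# `DivisionGap.PerCofactorDegreeReduction` (stmt-ValiantsHypothesis-15046), line `Sketch_ideator4`
# (intrinsic member descent): hardness of derangement-pair sums (registered stub `stub_derSumsHard`)

The first named member family of the residual class shared by the cruxes #8/#9 of route
`DivisionGap` is `h_der^N`, `h_der = Σ_{(π,ρ) nowhere agreeing} x^{P_π + P_ρ}`: every monomial is an
`N`-fold sum of NOWHERE-AGREEING permutation pairs, supports are simple 2-factors, so the cofactor is
line-saturated, aligned and pure-poor, and the padded hosts of the card do not bite (the fibre over a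
padded host is the complete class of `N`-sums of 2-factors of the host).  This file proves the raw
form of C⁺ for the whole structural class

  *every monomial of `h` is an `N`-sum of nowhere-agreeing pairs, and some monomial is the pure
  pair-power `N·(P_{π₀} + P_{ρ₀})` with `π₀ ⊔ ρ₀` Hamiltonian*

by MEMBER DESCENT TO A RIGID GADGET HOST: `GadgetPlacement.stub_gadgetPlacement` builds
`A = H₀ ∪ chords ⊇ H₀ = π₀ ⊔ ρ₀` with chord endpoints pairwise non-adjacent on `H₀` and containing a
placed subdivided `K_{b,b}`, `b = ⌊√(n/24)⌋`; `TwoFactorRigidity.stub_twoFactorRigidity` shows every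
pair of disjoint perfect matchings of `A` is `{π₀, ρ₀}` pointwise, so the only monomial of `h` inside
`A` is the pure pair-power (isolation); `IsolatedStrip.stub_isolatedStrip` (member descent + JSS
contraction) bounds `L⁺(per_A)` polynomially in `L⁺(per_n · h)`; `GadgetProjection.stub_gadgetProjection`
projects `per_A` onto `per_b`; Jerrum–Snir closes: `b (2^{b-1} - 1) ≤ 2 ((n+2)(L⁺(per_n·h)+3))^k`.

References: Jerrum–Snir 1982 §4.3 (the permanent bound); Jukna–Seiwert–Sergeev 2022 Lemma 2 (the
contraction); the rigidity/gadget combinatorics is folklore-level and proved in the imported files.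
-/

noncomputable section

set_option linter.dupNamespace false

namespace Summit.ValiantsHypothesis.ValiantsHypothesis.Theorems.DivisionGap.PerCofactorDegreeReduction.DerSumsHard

open MvPolynomial Literature.Computability.AlgebraicComplexity
open Summit.ValiantsHypothesis.ValiantsHypothesis.Theorems.DivisionGapPerDivisionHard (facePer)
open scoped NNReal

variable {n : ℕ}

/-- The support of a permutation monomial consists of its cells `(ρ i, i)`. [folklore] -/
theorem eq_of_mem_support_permMonomial (ρ : Equiv.Perm (Fin n)) {e : Fin n × Fin n}
    (he : e ∈ (permMonomial ρ).support) : e = (ρ e.2, e.2) := by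
  obtain ⟨r, c⟩ := e
  rw [Finsupp.mem_support_iff, permMonomial_apply] at he
  split_ifs at he with h
  · exact Prod.ext h.symm rfl
  · exact absurd rfl he

/-- A nonnegative integer combination of exponent vectors dominates each summand pointwise: if the
`k`-th pair contributes `1` at a cell, the sum is nonzero there. [folklore] -/
theorem mem_support_sum_of_pos {N : ℕ} (f : Fin N → (Fin n × Fin n) →₀ ℕ) (k : Fin N)
    {e : Fin n × Fin n} (he : f k e ≠ 0) : e ∈ (∑ j, f j).support := by
  rw [Finsupp.mem_support_iff, Finsupp.finsetSum_apply]
  intro hsum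
  have hle : f k e ≤ ∑ j, f j e :=
    Finset.single_le_sum (f := fun j => f j e) (fun j _ => Nat.zero_le _) (Finset.mem_univ k)
  omega

/-- The cell `(π i, i)` of a summand pair lies in the support of the sum. [folklore] -/
theorem cell_mem_support_sum {N : ℕ} (πs ρs : Fin N → Equiv.Perm (Fin n)) (k : Fin N) (i : Fin n) :
    (πs k i, i) ∈ (∑ j, (permMonomial (πs j) + permMonomial (ρs j))).support ∧
    (ρs k i, i) ∈ (∑ j, (permMonomial (πs j) + permMonomial (ρs j))).support := by
  have h1 : permMonomial (πs k) (πs k i, i) = 1 := by rw [permMonomial_apply, if_pos rfl]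
  have h2 : permMonomial (ρs k) (ρs k i, i) = 1 := by rw [permMonomial_apply, if_pos rfl]
  constructor
  · refine mem_support_sum_of_pos (fun j => permMonomial (πs j) + permMonomial (ρs j)) k ?_
    show (permMonomial (πs k) + permMonomial (ρs k)) (πs k i, i) ≠ 0
    rw [Finsupp.add_apply, h1]
    omega
  · refine mem_support_sum_of_pos (fun j => permMonomial (πs j) + permMonomial (ρs j)) k ?_
    show (permMonomial (πs k) + permMonomial (ρs k)) (ρs k i, i) ≠ 0
    rw [Finsupp.add_apply, h2]
    omega

/-- Two nowhere-agreeing pairs drawn pointwise from the same 2-set have the same pair sum: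
if `{π i, ρ i} ⊆ {π₀ i, ρ₀ i}` pointwise with `π i ≠ ρ i`, then `P_π + P_ρ = P_{π₀} + P_{ρ₀}`. [folklore] -/
theorem permMonomial_add_eq (π ρ π₀ ρ₀ : Equiv.Perm (Fin n))
    (hπ : ∀ i, π i = π₀ i ∨ π i = ρ₀ i) (hρ : ∀ i, ρ i = π₀ i ∨ ρ i = ρ₀ i) (hne : ∀ i, π i ≠ ρ i) :
    permMonomial π + permMonomial ρ = permMonomial π₀ + permMonomial ρ₀ := by
  ext ⟨r, c⟩
  simp only [Finsupp.add_apply, permMonomial_apply]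
  rcases hπ c with h1 | h1 <;> rcases hρ c with h2 | h2
  · exact absurd (h1.trans h2.symm) (hne c)
  · rw [h1, h2]
  · rw [h1, h2, add_comm]
  · exact absurd (h1.trans h2.symm) (hne c)

/-- An `n`-cycle `π₀⁻¹ρ₀` with full support has no fixed point, i.e. `π₀` and `ρ₀` agree nowhere.
[folklore] -/
theorem ne_of_support_eq_univ (π₀ ρ₀ : Equiv.Perm (Fin n))
    (hsupp : (π₀⁻¹ * ρ₀).support = Finset.univ) : ∀ i, π₀ i ≠ ρ₀ i := by
  intro i h
  have hi : i ∈ (π₀⁻¹ * ρ₀).support := hsupp ▸ Finset.mem_univ i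
  rw [Equiv.Perm.mem_support, Equiv.Perm.mul_apply] at hi
  apply hi
  rw [← h]
  simp

/-- **Hardness of derangement-pair sums (stub `stub_derSumsHard` of line `Sketch_ideator4`).**  If
every monomial of `h` is an `N`-fold sum of nowhere-agreeing permutation pairs and some monomial is the
pure pair-power `N·(P_{π₀}+P_{ρ₀})` with `π₀⁻¹ρ₀` an `n`-cycle (the 2-factor `π₀ ⊔ ρ₀` is Hamiltonian),
then `b (2^{b-1} - 1) ≤ 2 ((n+2)(L⁺(per_n · h)+3))^k` with `b = ⌊√(n/24)⌋` — weakly-exponential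
monotone hardness of `per_n · h` (e.g. `h = h_der^N`, all `N`).  Proof: rigid gadget host
(`stub_gadgetPlacement`), isolation by `stub_twoFactorRigidity`, `stub_isolatedStrip`,
`stub_gadgetProjection`, Jerrum–Snir `js_le_two_mul_complexity_perPoly`.
[cite: JerrumSnir1982, §4.3] -/
theorem stub_derSumsHard :
    ∃ k n₀ : ℕ, ∀ n ≥ n₀, ∀ (N : ℕ) (h : MvPolynomial (Fin n × Fin n) ℝ≥0) (π₀ ρ₀ : Equiv.Perm (Fin n)),
      (π₀⁻¹ * ρ₀).IsCycle → (π₀⁻¹ * ρ₀).support = Finset.univ →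
      N • (permMonomial π₀ + permMonomial ρ₀) ∈ h.support →
      (∀ v ∈ h.support, ∃ πs ρs : Fin N → Equiv.Perm (Fin n),
        (∀ k i, πs k i ≠ ρs k i) ∧ v = ∑ k, (permMonomial (πs k) + permMonomial (ρs k))) →
      Nat.sqrt (n / 24) * (2 ^ (Nat.sqrt (n / 24) - 1) - 1) ≤
        2 * ((n + 2) * (complexity (perPoly (Fin n) ℝ≥0 * h) + 3)) ^ k := by
  obtain ⟨k, hF1⟩ := IsolatedStrip.stub_isolatedStrip
  obtain ⟨n₀, hH⟩ := GadgetPlacement.stub_gadgetPlacement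
  refine ⟨k, n₀, fun n hn N h π₀ ρ₀ hcyc hsupp hu hv => ?_⟩
  obtain ⟨A, hH0, hchord, ra, cb, xc, yr, μ, hra, hcb, hxc, hyr, h1, h2, h3, h4⟩ :=
    hH n hn π₀ ρ₀ hcyc hsupp
  have hne : ∀ i, π₀ i ≠ ρ₀ i := ne_of_support_eq_univ π₀ ρ₀ hsupp
  have hrig := TwoFactorRigidity.stub_twoFactorRigidity n π₀ ρ₀ A hne hH0 hchord
  set u : (Fin n × Fin n) →₀ ℕ := N • (permMonomial π₀ + permMonomial ρ₀) with hudef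
  -- `supp u ⊆ A`
  have huA : u.support ⊆ A := by
    intro e he
    have he' : e ∈ (permMonomial π₀ + permMonomial ρ₀).support := Finsupp.support_smul he
    rcases Finset.mem_union.1 (Finsupp.support_add he') with h0 | h0
    · rw [eq_of_mem_support_permMonomial π₀ h0]; exact (hH0 e.2).1
    · rw [eq_of_mem_support_permMonomial ρ₀ h0]; exact (hH0 e.2).2
  -- isolation: the only monomial of `h` inside `A` is `u`
  have hiso : ∀ v ∈ h.support, v.support ⊆ A → v = u := by
    intro v hvs hvA
    obtain ⟨πs, ρs, hdis, rfl⟩ := hv v hvs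
    have hin : ∀ j i, (πs j i, i) ∈ A ∧ (ρs j i, i) ∈ A := fun j i =>
      ⟨hvA (cell_mem_support_sum πs ρs j i).1, hvA (cell_mem_support_sum πs ρs j i).2⟩
    have hsum : ∀ j, permMonomial (πs j) + permMonomial (ρs j) =
        permMonomial π₀ + permMonomial ρ₀ := by
      intro j
      refine permMonomial_add_eq _ _ _ _ ?_ ?_ (hdis j)
      · exact hrig (πs j) (ρs j) (fun i => (hin j i).1) (fun i => (hin j i).2) (hdis j)
      · exact hrig (ρs j) (πs j) (fun i => (hin j i).2) (fun i => (hin j i).1)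
          (fun i => (hdis j i).symm)
    rw [hudef, Finset.sum_congr rfl fun j _ => hsum j, Finset.sum_const, Finset.card_univ,
      Fintype.card_fin]
  -- strip, project, Jerrum–Snir
  have hstrip := hF1 n h u A hu huA hiso
  have hproj := GadgetProjection.stub_gadgetProjection n (Nat.sqrt (n / 24)) A ra cb xc yr μ
    hra hcb hxc hyr h1 h2 h3 h4
  rcases Nat.eq_zero_or_pos (Nat.sqrt (n / 24)) with hb | hb
  · rw [hb, zero_mul]; exact Nat.zero_le _
  · calc Nat.sqrt (n / 24) * (2 ^ (Nat.sqrt (n / 24) - 1) - 1)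
        ≤ 2 * complexity (perPoly (Fin (Nat.sqrt (n / 24))) ℝ≥0) :=
          Summit.ValiantsHypothesis.Theorems.PerDivisionHardNegative.js_le_two_mul_complexity_perPoly hb
      _ ≤ 2 * ((n + 2) * (complexity (perPoly (Fin n) ℝ≥0 * h) + 3)) ^ k :=
          Nat.mul_le_mul_left 2 (hproj.trans hstrip)

end Summit.ValiantsHypothesis.ValiantsHypothesis.Theorems.DivisionGap.PerCofactorDegreeReduction.DerSumsHard

end
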